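import Summits.Ventures.WeilGRH.TwistedSechSeries
import HarnessLib

/-!
# GRH arm (rh-explicit, venture WeilGRH): the `sech` expansion with the HALF-TERM correction — remainder `O(K⁻³)`

Cell `rh-explicit`, WEIL TRACK — GRH ARM (engine seat weil-grh-2 gen9).  Sequel of `TwistedSechSeries.lean`
(weil-grh-1): the exact tail of the alternating expansion of `σ(t) = 1/(2cosh(t/2))` is
`(−1)^K e^{−(K+½)t}/(1 + e^{−t})` (`sech_density_sub_partial_sum`).  Adding HALF of the first omitted term
(the first step of the Euler transform) leaves `(−1)^K e^{−(K+½)t}(1/(1+e^{−t}) − ½)`, and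
`0 ≤ 1/(1+e^{−t}) − ½ ≤ t/2` for `t ≥ 0`, so against a kernel with `|F(t)| ≤ C·t` on `(0, T]`

* `abs_integral_sech_mul_sub_sum_half_le`:
  `|∫_{(0,T]} σF − Σ_{k<K} (−1)^k ∫ e^{−(k+½)t}F − ((−1)^K/2)·∫ e^{−(K+½)t}F| ≤ C/(K+½)³`

(against `C/(K+½)²` without the half term).  For the interval tables of the `sech` block
(`TwistedSechTable*.lean`) this divides the truncation order `K` needed for a given entry radius by `≈ K^{1/3}·…`:
`K = 64` with the half term beats `K = 512` without it.  No definitions; no named facts; RH/GRH-free.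
References: the Euler transform of alternating series [folklore]; H. Yoshida (1992) §5 [Yoshida1992HermitianForms].
-/

set_option autoImplicit false

noncomputable section

open Filter Set MeasureTheory
open scoped Real Topology

namespace Summit.Ventures.WeilGRH

/-! ## The half-term correction of the finite expansion of `σ` -/

/-- `0 ≤ 1/(1+e^{−t}) − ½ ≤ t/2` for `t ≥ 0` (from `1 − t ≤ e^{−t}`). -/
theorem logistic_sub_half_bounds {t : ℝ} (ht : 0 ≤ t) :
    0 ≤ 1 / (1 + Real.exp (-t)) - 1 / 2 ∧ 1 / (1 + Real.exp (-t)) - 1 / 2 ≤ t / 2 := by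
  have hu : 0 < Real.exp (-t) := Real.exp_pos _
  have hu1 : Real.exp (-t) ≤ 1 := by rw [Real.exp_le_one_iff]; linarith
  have hpos : 0 < 1 + Real.exp (-t) := by positivity
  have hlin : 1 - t ≤ Real.exp (-t) := by linarith [Real.add_one_le_exp (-t)]
  have heq : 1 / (1 + Real.exp (-t)) - 1 / 2 = (1 - Real.exp (-t)) / (2 * (1 + Real.exp (-t))) := by
    field_simp; ring
  rw [heq]
  refine ⟨div_nonneg (by linarith) (by positivity), ?_⟩
  rw [div_le_div_iff₀ (by positivity) (by norm_num : (0 : ℝ) < 2)]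
  nlinarith [mul_nonneg ht hu.le]

/-- **The half-corrected expansion**: for all real `t` and `K`,
`σ(t) − Σ_{k<K} (−1)^k e^{−(k+½)t} − ((−1)^K/2) e^{−(K+½)t} = (−1)^K e^{−(K+½)t}(1/(1+e^{−t}) − ½)`. -/
theorem sech_density_sub_partial_sum_sub_half (t : ℝ) (K : ℕ) :
    1 / (2 * Real.cosh (t / 2)) - ∑ k ∈ Finset.range K, (-1 : ℝ) ^ k * Real.exp (-((k + 1 / 2) * t))
        - (-1 : ℝ) ^ K / 2 * Real.exp (-((K + 1 / 2) * t)) =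
      (-1 : ℝ) ^ K * Real.exp (-((K + 1 / 2) * t)) * (1 / (1 + Real.exp (-t)) - 1 / 2) := by
  rw [sech_density_sub_partial_sum]
  ring

/-- `|σ(t) − S_K(t) − ((−1)^K/2) e^{−(K+½)t}| ≤ e^{−(K+½)t}·(t/2)` for `t ≥ 0`. -/
theorem abs_sech_density_sub_partial_sum_sub_half_le {t : ℝ} (ht : 0 ≤ t) (K : ℕ) :
    |1 / (2 * Real.cosh (t / 2)) - ∑ k ∈ Finset.range K, (-1 : ℝ) ^ k * Real.exp (-((k + 1 / 2) * t))
        - (-1 : ℝ) ^ K / 2 * Real.exp (-((K + 1 / 2) * t))| ≤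
      Real.exp (-((K + 1 / 2) * t)) * (t / 2) := by
  obtain ⟨h0, h1⟩ := logistic_sub_half_bounds ht
  rw [sech_density_sub_partial_sum_sub_half, abs_mul, abs_mul, abs_pow, abs_neg, abs_one, one_pow, one_mul,
    Real.abs_exp, abs_of_nonneg h0]
  exact mul_le_mul_of_nonneg_left h1 (Real.exp_pos _).le

/-! ## Termwise integration with the half term -/

/-- `∫₀^∞ t² e^{−ct} dt = 2/c³` (`c > 0`). -/
theorem integral_sq_mul_exp_neg_mul_Ioi {c : ℝ} (hc : 0 < c) :
    ∫ t in Ioi (0 : ℝ), t ^ 2 * Real.exp (-(c * t)) = 2 / c ^ 3 := by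
  have h := Real.integral_rpow_mul_exp_neg_mul_Ioi (a := 3) (r := c) (by norm_num) hc
  have hG : Real.Gamma 3 = 2 := by
    rw [show (3 : ℝ) = (2 : ℕ) + 1 by norm_num, Real.Gamma_nat_eq_factorial]
    norm_num
  rw [show (3 : ℝ) - 1 = 2 by norm_num, hG, show (1 / c) ^ (3 : ℝ) = 1 / c ^ 3 by
    rw [show (3 : ℝ) = (3 : ℕ) by norm_num, Real.rpow_natCast]; ring] at h
  rw [show 2 / c ^ 3 = 1 / c ^ 3 * 2 by ring, ← h]
  refine setIntegral_congr_fun measurableSet_Ioi fun t _ ↦ ?_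
  rw [show (2 : ℝ) = (2 : ℕ) by norm_num, Real.rpow_natCast]

/-- `t ↦ t² e^{−ct}` is integrable on `(0, ∞)` (`c > 0`). -/
theorem integrableOn_sq_mul_exp_neg_mul_Ioi {c : ℝ} (hc : 0 < c) :
    IntegrableOn (fun t : ℝ ↦ t ^ 2 * Real.exp (-(c * t))) (Ioi 0) := by
  have h : ∫ t in Ioi (0 : ℝ), t ^ 2 * Real.exp (-(c * t)) ≠ 0 := by
    rw [integral_sq_mul_exp_neg_mul_Ioi hc]; positivity
  exact Integrable.of_integral_ne_zero h

/-- **Termwise integration of the `sech` block with the half-term correction**: if `F` is measurable with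
`|F(t)| ≤ C·t` on `(0, T]`, then
`|∫_{(0,T]} σ F − Σ_{k<K} (−1)^k ∫_{(0,T]} e^{−(k+½)t} F − ((−1)^K/2) ∫_{(0,T]} e^{−(K+½)t} F| ≤ C/(K+½)³`. -/
theorem abs_integral_sech_mul_sub_sum_half_le {F : ℝ → ℝ} {C T : ℝ} (hF : Measurable F) (hC : 0 ≤ C)
    (hb : ∀ t ∈ Ioc 0 T, |F t| ≤ C * t) (K : ℕ) :
    |(∫ t in Ioc 0 T, 1 / (2 * Real.cosh (t / 2)) * F t) -
        (∑ k ∈ Finset.range K, (-1 : ℝ) ^ k * ∫ t in Ioc 0 T, Real.exp (-((k + 1 / 2) * t)) * F t)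
        - (-1 : ℝ) ^ K / 2 * ∫ t in Ioc 0 T, Real.exp (-((K + 1 / 2) * t)) * F t| ≤
      C / (K + 1 / 2) ^ 3 := by
  rcases le_or_gt T 0 with hT | hT
  · have he : Ioc 0 T = ∅ := Ioc_eq_empty (not_lt.2 hT)
    simp only [he, Measure.restrict_empty, integral_zero_measure, mul_zero, Finset.sum_const_zero, sub_zero,
      abs_zero]
    positivity
  -- `F` is bounded on `(0, T]`, hence every integrand is integrable there
  have hFb : ∀ t ∈ Ioc 0 T, |F t| ≤ C * T := fun t ht ↦
    (hb t ht).trans (mul_le_mul_of_nonneg_left ht.2 hC)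
  have hfin : volume (Ioc 0 T) < ⊤ := by simp [Real.volume_Ioc]
  have hint : ∀ {g : ℝ → ℝ}, Measurable g → (∀ t ∈ Ioc 0 T, |g t| ≤ 1) →
      IntegrableOn (fun t ↦ g t * F t) (Ioc 0 T) := by
    intro g hg hg1
    refine Measure.integrableOn_of_bounded (M := C * T) hfin.ne ((hg.mul hF).aestronglyMeasurable)
      ((ae_restrict_iff' measurableSet_Ioc).2 (Eventually.of_forall fun t ht ↦ ?_))
    rw [Real.norm_eq_abs, abs_mul]
    calc |g t| * |F t| ≤ 1 * (C * T) := mul_le_mul (hg1 t ht) (hFb t ht) (abs_nonneg _) zero_le_one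
      _ = C * T := one_mul _
  have hσ1 : ∀ t ∈ Ioc 0 T, |1 / (2 * Real.cosh (t / 2))| ≤ 1 := fun t _ ↦ by
    rw [abs_of_pos (sech_density_pos t)]
    have := Real.one_le_cosh (t / 2)
    rw [div_le_one (by positivity)]; linarith
  have hek : ∀ k : ℕ, ∀ t ∈ Ioc 0 T, |Real.exp (-((k + 1 / 2) * t))| ≤ 1 := fun k t ht ↦ by
    rw [Real.abs_exp, Real.exp_le_one_iff]; nlinarith [ht.1]
  have hmk : ∀ k : ℕ, Measurable fun t : ℝ ↦ Real.exp (-((k + 1 / 2) * t)) := fun k ↦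
    (Real.continuous_exp.comp (by fun_prop)).measurable
  have hIσ := hint continuous_sech_density.measurable hσ1
  have hIk : ∀ k : ℕ, IntegrableOn (fun t ↦ Real.exp (-((k + 1 / 2) * t)) * F t) (Ioc 0 T) :=
    fun k ↦ hint (hmk k) (hek k)
  -- the corrected partial sum `S_K + ((−1)^K/2) e_K`
  set SK : ℝ → ℝ := fun t ↦ ∑ k ∈ Finset.range K, (-1 : ℝ) ^ k * Real.exp (-((k + 1 / 2) * t))
    + (-1 : ℝ) ^ K / 2 * Real.exp (-((K + 1 / 2) * t)) with hSK
  have hIS : IntegrableOn (fun t ↦ SK t * F t) (Ioc 0 T) := by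
    have : (fun t ↦ SK t * F t) =
        fun t ↦ ∑ k ∈ Finset.range K, (-1 : ℝ) ^ k * (Real.exp (-((k + 1 / 2) * t)) * F t)
          + (-1 : ℝ) ^ K / 2 * (Real.exp (-((K + 1 / 2) * t)) * F t) := by
      funext t; rw [hSK]; dsimp only; rw [add_mul, Finset.sum_mul]
      congr 1
      · exact Finset.sum_congr rfl fun k _ ↦ by ring
      · ring
    rw [this]
    exact (integrable_finsetSum _ fun k _ ↦ (hIk k).const_mul _).add ((hIk K).const_mul _)
  have hID : IntegrableOn (fun t ↦ (1 / (2 * Real.cosh (t / 2)) - SK t) * F t) (Ioc 0 T) :=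
    (hIσ.sub hIS).congr_fun (fun t _ ↦ by simp only [Pi.sub_apply]; ring) measurableSet_Ioc
  have hsumInt : ∫ t in Ioc 0 T, SK t * F t =
      (∑ k ∈ Finset.range K, (-1 : ℝ) ^ k * ∫ t in Ioc 0 T, Real.exp (-((k + 1 / 2) * t)) * F t)
        + (-1 : ℝ) ^ K / 2 * ∫ t in Ioc 0 T, Real.exp (-((K + 1 / 2) * t)) * F t := by
    have h1 : ∫ t in Ioc 0 T, SK t * F t =
        (∫ t in Ioc 0 T, ∑ k ∈ Finset.range K, (-1 : ℝ) ^ k * (Real.exp (-((k + 1 / 2) * t)) * F t))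
          + ∫ t in Ioc 0 T, (-1 : ℝ) ^ K / 2 * (Real.exp (-((K + 1 / 2) * t)) * F t) := by
      rw [← integral_add (integrable_finsetSum _ fun k _ ↦ (hIk k).const_mul ((-1 : ℝ) ^ k))
        ((hIk K).const_mul _)]
      refine setIntegral_congr_fun measurableSet_Ioc fun t _ ↦ ?_
      rw [hSK]; dsimp only; rw [add_mul, Finset.sum_mul]
      congr 1
      · exact Finset.sum_congr rfl fun k _ ↦ by ring
      · ring
    rw [h1, integral_finsetSum _ (fun k _ ↦ (hIk k).const_mul ((-1 : ℝ) ^ k)),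
      integral_const_mul ((-1 : ℝ) ^ K / 2)]
    congr 1
    exact Finset.sum_congr rfl fun k _ ↦ integral_const_mul ((-1 : ℝ) ^ k) _
  have hdiff : (∫ t in Ioc 0 T, 1 / (2 * Real.cosh (t / 2)) * F t) -
      (∑ k ∈ Finset.range K, (-1 : ℝ) ^ k * ∫ t in Ioc 0 T, Real.exp (-((k + 1 / 2) * t)) * F t)
      - (-1 : ℝ) ^ K / 2 * ∫ t in Ioc 0 T, Real.exp (-((K + 1 / 2) * t)) * F t =
      ∫ t in Ioc 0 T, (1 / (2 * Real.cosh (t / 2)) - SK t) * F t := by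
    rw [sub_sub, ← hsumInt, ← integral_sub hIσ hIS]
    refine setIntegral_congr_fun measurableSet_Ioc fun t _ ↦ ?_
    ring
  rw [hdiff]
  -- bound by `∫_{(0,T]} C t·(t/2) e^{−(K+½)t} ≤ (C/2)∫₀^∞ t² e^{−(K+½)t} = C/(K+½)³`
  have hc : (0 : ℝ) < K + 1 / 2 := by positivity
  have hdom : IntegrableOn (fun t : ℝ ↦ C / 2 * (t ^ 2 * Real.exp (-((K + 1 / 2) * t)))) (Ioi 0) :=
    (integrableOn_sq_mul_exp_neg_mul_Ioi hc).const_mul (C / 2)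
  have hpt : ∀ t ∈ Ioc 0 T, 1 / (2 * Real.cosh (t / 2)) - SK t =
      1 / (2 * Real.cosh (t / 2)) - ∑ k ∈ Finset.range K, (-1 : ℝ) ^ k * Real.exp (-((k + 1 / 2) * t))
        - (-1 : ℝ) ^ K / 2 * Real.exp (-((K + 1 / 2) * t)) := fun t _ ↦ by rw [hSK]; dsimp only; ring
  calc |∫ t in Ioc 0 T, (1 / (2 * Real.cosh (t / 2)) - SK t) * F t|
      ≤ ∫ t in Ioc 0 T, C / 2 * (t ^ 2 * Real.exp (-((K + 1 / 2) * t))) := by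
        rw [← Real.norm_eq_abs]
        refine (norm_integral_le_integral_norm _).trans
          (setIntegral_mono_on hID.norm (hdom.mono_set Ioc_subset_Ioi_self) measurableSet_Ioc fun t ht ↦ ?_)
        rw [Real.norm_eq_abs, abs_mul, hpt t ht]
        calc |1 / (2 * Real.cosh (t / 2)) - ∑ k ∈ Finset.range K, (-1 : ℝ) ^ k * Real.exp (-((k + 1 / 2) * t))
                - (-1 : ℝ) ^ K / 2 * Real.exp (-((K + 1 / 2) * t))| * |F t|
              ≤ Real.exp (-((K + 1 / 2) * t)) * (t / 2) * (C * t) :=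
            mul_le_mul (abs_sech_density_sub_partial_sum_sub_half_le ht.1.le K) (hb t ht) (abs_nonneg _)
              (by have := Real.exp_pos (-((K + 1 / 2 : ℝ) * t)); have := ht.1; positivity)
          _ = C / 2 * (t ^ 2 * Real.exp (-((K + 1 / 2) * t))) := by ring
    _ ≤ ∫ t in Ioi 0, C / 2 * (t ^ 2 * Real.exp (-((K + 1 / 2) * t))) :=
        setIntegral_mono_set hdom
          ((ae_restrict_iff' measurableSet_Ioi).2 (Eventually.of_forall fun t (ht : 0 < t) ↦ by
            have := Real.exp_pos (-((K + 1 / 2 : ℝ) * t)); positivity))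
          Ioc_subset_Ioi_self.eventuallyLE
    _ = C / (K + 1 / 2) ^ 3 := by
        rw [integral_const_mul, integral_sq_mul_exp_neg_mul_Ioi hc]; ring

end Summit.Ventures.WeilGRH

end

/-! ### Build note
weil-grh-2 gen11, 2026-08-24: append-only re-commit of the file accepted as p371591 (2026-08-23) so that the hub builder
produces its olean (the build window it fell in was skipped; importer probes answer `remote:stale:…:unbuilt`).  No declaration is added or changed. -/
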